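import Summits.CriticalPhenomena.PercolationContinuityZ3.Theorems.PercNearOneGluingNoHeavyLowerTailSahiCTCN2FiveTab
import Summits.CriticalPhenomena.PercolationContinuityZ3.Theorems.PercNearOneGluingNoHeavyLowerTailSahiCTCNcGen
import HarnessLib

/-!
# `NoHeavyLowerTail` (crux stmt-CriticalPhenomena-4575), P3 lane: VERIFIED COEFFICIENT TABLES for the level-3 certificate polynomial `Ñ₃` on
# five points — a computable evaluator `n3Tab K_X K_Z` whose entries are, provably, the coefficients of `Ngen 3 K_X K_Z`

Support file (seat `prim-l12-p3`, gen 21; `--supports stmt-CriticalPhenomena-4575`; `--computational` through `…SahiCTCN2FiveTab`, whose digit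
facts were discharged by `native_decide`; everything here is proved).  Memo `run/shared/lean/prim/prim-l12/FROM-prim-l12-p3-g21-*.md`.

This is `…SahiCTCN2FiveTab` §"The table of Ñ₂" for the level `c = 3`: the table machinery (`codeOf`, `fsOf`, `mulFam`, `rep_mulFam`,
`tabNonneg`) is reused verbatim; `n3Tab` assembles `Ñ₃ = Ngen 3` (`…SahiCTCNcGen`) along its definition (`rep_n3Tab`), `Ñ_c` has degree `≤ 4` in
each variable (`degreeOf_Ngen_le`), and `coeff_Ngen3_nonneg_of_tabNonneg`: if every entry of `n3Tab K_X K_Z` is `≥ 0` then `Ñ₃(K_X,K_Z) ∈ ℕ[r]`.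
Purpose: the kernel check of the level-3 coefficientwise threshold certificate on five points (`…SahiCTCN3Five`), hence Kahn's Conjecture 5 /
Sahi's `C₃` for the first slot "at least two of five open".  Nothing is asserted about the crux.
-/

namespace Summit.CriticalPhenomena.PercolationContinuityZ3.Theorems.SahiCTCForms

open Finset MvPolynomial SahiCTCGenFun

namespace N3Five

open N2Five

/-! ### Degree bound: coefficients of `Ñ_c` at exponent vectors with an entry `≥ 5` vanish -/

section deg
variable (c : ℕ) (KX KZ : Finset (Finset (Fin 5)))

/-- `Ñ_c` has degree `≤ 4` in each variable. [this work] -/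
theorem degreeOf_Ngen_le (i : Fin 5) : degreeOf i (Ngen c KX KZ) ≤ 4 := by
  have hg : ∀ F : Finset (Finset (Fin 5)), degreeOf i (gf F) ≤ 1 := fun F => degreeOf_gf_le F i
  have hPi : degreeOf i (PiP : MvPolynomial (Fin 5) ℤ) ≤ 1 := hg _
  have hDd : degreeOf i (DdC c : MvPolynomial (Fin 5) ℤ) ≤ 1 := hg _
  have hTh : degreeOf i (ThC c : MvPolynomial (Fin 5) ℤ) ≤ 1 := hg _
  have hec : degreeOf i (ee c : MvPolynomial (Fin 5) ℤ) ≤ 1 := hg _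
  have mul2 : ∀ {p q : MvPolynomial (Fin 5) ℤ} {a b : ℕ}, degreeOf i p ≤ a → degreeOf i q ≤ b → degreeOf i (p * q) ≤ a + b :=
    fun hp hq => (degreeOf_mul_le i _ _).trans (Nat.add_le_add hp hq)
  have add2 : ∀ {p q : MvPolynomial (Fin 5) ℤ} {a : ℕ}, degreeOf i p ≤ a → degreeOf i q ≤ a → degreeOf i (p + q) ≤ a :=
    fun hp hq => (degreeOf_add_le i _ _).trans (max_le hp hq)
  have sub2 : ∀ {p q : MvPolynomial (Fin 5) ℤ} {a : ℕ}, degreeOf i p ≤ a → degreeOf i q ≤ a → degreeOf i (p - q) ≤ a :=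
    fun hp hq => (degreeOf_sub_le i _ _).trans (max_le hp hq)
  unfold Ngen
  refine add2 (sub2 (sub2 ?_ ?_) ?_) ?_
  · exact (mul2 (mul2 hec (add2 hPi hDd)) (sub2 (mul2 hPi (hg _)) (mul2 (hg _) (hg _)))).trans (by norm_num)
  · exact (mul2 (mul2 (mul2 hTh hPi) hDd) (hg _)).trans (by norm_num)
  · exact (mul2 (mul2 hec hDd) (add2 (mul2 (hg _) (hg _)) (mul2 (hg _) (hg _)))).trans (by norm_num)
  · exact (mul2 (mul2 (mul2 hec hTh) (hg _)) (hg _)).trans (by norm_num)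

/-- Coefficients of `Ñ_c` vanish at exponent vectors with an entry `≥ 5`. [this work] -/
theorem coeff_Ngen_eq_zero_of_large {n : Fin 5 →₀ ℕ} (hn : ¬ ∀ i, n i ≤ 4) : (Ngen c KX KZ).coeff n = 0 := by
  by_contra h
  apply hn; intro i
  exact (degreeOf_le_iff.1 (degreeOf_Ngen_le c KX KZ i)) n (mem_support_iff.2 h)

end deg

/-! ### The table of `Ñ₃(K_X, K_Z)` -/

/-- Codes of the sets of size `> 3`. [this work] -/
def dd3C : Multiset ℕ := famCodes (bySize (3 < ·) : Finset (Finset (Fin 5)))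
/-- Codes of the sets of size `≤ 3`. [this work] -/
def th3C : Multiset ℕ := famCodes (bySize (· ≤ 3) : Finset (Finset (Fin 5)))
/-- Codes of the sets of size `3`. [this work] -/
def e3C : Multiset ℕ := famCodes (bySize (· = 3) : Finset (Finset (Fin 5)))
/-- Table of `(Π + D₃)·e₃`. [this work] -/
def tabB3 : Array ℤ := addTab (mulFam (mulFam oneTab e3C) allC) (mulFam (mulFam oneTab e3C) dd3C)
/-- Table of `Π·(Π + D₃)·e₃`. [this work] -/
def tabA3 : Array ℤ := mulFam tabB3 allC
/-- Table of `D₃·Π·Θ₃`. [this work] -/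
def tabC3 : Array ℤ := mulFam (mulFam (mulFam oneTab th3C) allC) dd3C
/-- Table of `D₃·e₃`. [this work] -/
def tabE3 : Array ℤ := mulFam (mulFam oneTab e3C) dd3C
/-- Table of `Θ₃·e₃`. [this work] -/
def tabG3 : Array ℤ := mulFam (mulFam oneTab e3C) th3C

/-- The table of `Ñ₃(K_X,K_Z)` (assembled exactly along the definition of `Ngen 3`). [this work] -/
def n3Tab (KX KZ : Finset (Finset (Fin 5))) : Array ℤ :=
  addTab (subTab (subTab (subTab
    (mulFam tabA3 (famCodes (commonLE 3 KX KZ)))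
    (mulFam (mulFam tabB3 (famCodes (facesLE 3 KX))) (famCodes (facesLE 3 KZ))))
    (mulFam tabC3 (famCodes (commonEQ 3 KX KZ))))
    (addTab (mulFam (mulFam tabE3 (famCodes (facesLE 3 KX))) (famCodes (facesGT 3 KZ)))
      (mulFam (mulFam tabE3 (famCodes (facesGT 3 KX))) (famCodes (facesLE 3 KZ)))))
    (mulFam (mulFam tabG3 (famCodes (facesGT 3 KX))) (famCodes (facesGT 3 KZ)))

/-- **`n3Tab` tabulates `Ñ₃`.** [this work] -/
theorem rep_n3Tab (KX KZ : Finset (Finset (Fin 5))) : (∀ f : Fin 5 → Fin 5, (n3Tab KX KZ).getD (codeOf f) 0 = (Ngen 3 KX KZ).coeff (fsOf f)) := by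
  have hB : (∀ f : Fin 5 → Fin 5, (tabB3).getD (codeOf f) 0 = ((PiP * (ee 3 * 1) + DdC 3 * (ee 3 * 1) : MvPolynomial (Fin 5) ℤ)).coeff (fsOf f)) :=
    rep_add (rep_mulFam (rep_mulFam rep_one _) _) (rep_mulFam (rep_mulFam rep_one _) _)
  have hA : (∀ f : Fin 5 → Fin 5, (tabA3).getD (codeOf f) 0 = ((PiP * (PiP * (ee 3 * 1) + DdC 3 * (ee 3 * 1)) : MvPolynomial (Fin 5) ℤ)).coeff (fsOf f)) :=
    rep_mulFam hB _
  have hC : (∀ f : Fin 5 → Fin 5, (tabC3).getD (codeOf f) 0 = ((DdC 3 * (PiP * (ThC 3 * 1)) : MvPolynomial (Fin 5) ℤ)).coeff (fsOf f)) :=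
    rep_mulFam (rep_mulFam (rep_mulFam rep_one _) _) _
  have hE : (∀ f : Fin 5 → Fin 5, (tabE3).getD (codeOf f) 0 = ((DdC 3 * (ee 3 * 1) : MvPolynomial (Fin 5) ℤ)).coeff (fsOf f)) :=
    rep_mulFam (rep_mulFam rep_one _) _
  have hG : (∀ f : Fin 5 → Fin 5, (tabG3).getD (codeOf f) 0 = ((ThC 3 * (ee 3 * 1) : MvPolynomial (Fin 5) ℤ)).coeff (fsOf f)) :=
    rep_mulFam (rep_mulFam rep_one _) _
  have key := rep_add (rep_sub (rep_sub (rep_sub (rep_mulFam hA (commonLE 3 KX KZ))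
    (rep_mulFam (rep_mulFam hB (facesLE 3 KX)) (facesLE 3 KZ))) (rep_mulFam hC (commonEQ 3 KX KZ)))
    (rep_add (rep_mulFam (rep_mulFam hE (facesLE 3 KX)) (facesGT 3 KZ)) (rep_mulFam (rep_mulFam hE (facesGT 3 KX)) (facesLE 3 KZ))))
    (rep_mulFam (rep_mulFam hG (facesGT 3 KX)) (facesGT 3 KZ))
  intro f
  unfold n3Tab
  rw [key f]
  refine congrArg (MvPolynomial.coeff (fsOf f)) ?_
  unfold Ngen
  ring

/-- **Soundness of the table check**: if every entry of `n3Tab K_X K_Z` is `≥ 0` then `Ñ₃(K_X,K_Z) ∈ ℕ[r]`. [this work] -/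
theorem coeff_Ngen3_nonneg_of_tabNonneg {KX KZ : Finset (Finset (Fin 5))} (h : tabNonneg (n3Tab KX KZ) = true) (n : Fin 5 →₀ ℕ) :
    0 ≤ (Ngen 3 KX KZ).coeff n := by
  by_cases hn : ∀ i, n i ≤ 4
  · obtain ⟨f, rfl⟩ := exists_fsOf_of_small hn
    rw [← rep_n3Tab KX KZ f]
    rw [tabNonneg, List.all_eq_true] at h
    have := h (codeOf f) (List.mem_range.2 (codeOf_lt f))
    exact of_decide_eq_true this
  · rw [coeff_Ngen_eq_zero_of_large 3 KX KZ hn]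

end N3Five

end Summit.CriticalPhenomena.PercolationContinuityZ3.Theorems.SahiCTCForms
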